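import Literature.AlgebraicGeometry.Motives.RatFnBirationalHartogs
import Literature.AlgebraicGeometry.Motives.CartierDivisorCurveDegree
import Literature.AlgebraicGeometry.Motives.CartierDivisorClassPullback
import Literature.AlgebraicGeometry.Resolution.ResolutionOfSingularities
import HarnessLib

/-!
# Cartier divisors on a regular scheme are determined by their orders at the codimension-one points
# (`Div(X) → Z¹(X)` is injective; algebraic Hartogs without a cover)

Layer `Literature/AlgebraicGeometry/Motives`, namespaces `Literature.AlgebraicGeometry.Motives.RatFn` (§1–§2)
and `Literature.AlgebraicGeometry.Motives.CartierDivisor` (§3).  KERNEL ONLY (theorems; no definition, no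
named fact, no instance, no `sorry`).

Let `X` be an integral locally Noetherian scheme all of whose local rings are regular
(`Scheme.IsRegular X`, e.g. a smooth variety over a field, an abelian variety).  Then
(Hartshorne II Prop. 6.11 and Rem. 6.11.2; Görtz–Wedhorn I, Thm. 11.38 (1) with Thm. 6.45: on a normal —
a fortiori locally factorial — Noetherian integral scheme the cycle map `Div(X) → Z¹(X)`,
`D ↦ Σ_{codim C = 1} ord_C(D) [C]`, is injective):

* §1 `RatFn.isUnitAt_of_ord_eq_zero` — at a CODIMENSION-ONE point `z` (`coheight z = 1`) with regular
  (hence discrete-valuation) local ring, a nonzero rational function of order `0` is a unit of `𝒪_{X,z}`;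
* §2 `RatFn.isRegularAt_of_forall_coheight_le_one` — **ALGEBRAIC HARTOGS** (Görtz–Wedhorn I, Thm. 6.45:
  `Γ(U, 𝒪_X) = ⋂_{codim x ≤ 1} 𝒪_{X,x}` for `X` normal Noetherian): a rational function regular at every
  point of codimension `≤ 1` of an open `W` is regular at every point of `W` — the cover-free re-cut
  (`π := 𝟙`) of ★ `Motives/RatFnBirationalHartogs` (same two-step proof: `𝒪_{X,y}` is factorial
  (Auslander–Buchsbaum), hence the intersection of its localisations at prime elements
  (★ `Literature.RingTheory.UniqueFactorizationDomain.exists_algebraMap_eq_of_forall_prime`), and these are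
  the local rings at the codimension-one generizations of `y`); and `RatFn.isUnitAt_of_forall_ord_eq_zero` —
  a nonzero rational function of order `0` at every codimension-one point of `W` is a unit at every point
  of `W`;
* §3 `CartierDivisor.sameDivisor_of_forall_ordAt_eq` — **two Cartier divisors with the same order at every
  codimension-one point are the same divisor** (`SameDivisor`), `CartierDivisor.sameDivisor_of_cycle_eq` —
  the Weil-cycle map ★ `CartierDivisor.cycle` is injective up to `SameDivisor`, and the `iff` forms.

These are the «Cartier = Weil for reducible supports» inputs banked as (App1-gen) in the cell
`hodgecm-mathlib` (Mumford §6 Application 1 for an ARBITRARY effective divisor on an abelian variety: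
a translation fixing every irreducible component of `Supp D` fixes `D`, by comparing orders at the
generic points of the components).

## References

* [Hartshorne1977] R. Hartshorne, *Algebraic Geometry*, GTM 52 (1977), II.6, Prop. 6.11 and
  Remark 6.11.2 (pp. 141–142): Cartier versus Weil divisors on locally factorial / normal schemes;
  Prop. 6.3A: a normal Noetherian domain is the intersection of its localisations at height-one primes.
* [GortzWedhorn2020] U. Görtz, T. Wedhorn, *Algebraic Geometry I*, 2nd ed. (2020), Thm. 6.45 (p. 167)
  (algebraic Hartogs), (11.13.3) and Lemma 11.37 (p. 309), Thm. 11.38 (1) (`cyc : Div(X) → Z¹(X)` injective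
  for `X` normal), Prop. B.73 (3) (p. 571).
* [Matsumura1987] H. Matsumura, *Commutative Ring Theory*, CSAM 8 (1986), Thm. 11.2 (p. 79) (regular local
  of dimension one = DVR), Thm. 20.3 (regular local rings are factorial).
-/

set_option autoImplicit false

universe u

open CategoryTheory AlgebraicGeometry TopologicalSpace IsLocalRing Ideal Order
open Literature.RingTheory.UniqueFactorizationDomain Literature.AlgebraicGeometry.Resolution

noncomputable section

namespace Literature.AlgebraicGeometry.Motives

namespace RatFn

variable {X : Scheme.{u}} [IsIntegral X]

/-! ## §1 Codimension one: order `0` means unit -/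

omit [IsIntegral X] in
/-- The local ring at a point of codimension `≤ 1` has Krull dimension `≤ 1`. [folklore] -/
private theorem ringKrullDim_stalk_le_one_of_coheight_le_one {z : X} (hz : coheight z ≤ 1) :
    ringKrullDim (X.presheaf.stalk z) ≤ 1 := by
  rw [AlgebraicGeometry.ringKrullDim_stalk_eq_coheight z]
  exact_mod_cast hz

omit [IsIntegral X] in
/-- Conversely, a point whose local ring has Krull dimension `≤ 1` has codimension `≤ 1`. [folklore] -/
private theorem coheight_le_one_of_ringKrullDim_stalk_le_one {z : X}
    (hz : ringKrullDim (X.presheaf.stalk z) ≤ 1) : coheight z ≤ 1 := by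
  rw [AlgebraicGeometry.ringKrullDim_stalk_eq_coheight z] at hz
  exact_mod_cast hz

/-- **At a codimension-one point with regular local ring, a nonzero rational function of order `0` is a
unit** (`𝒪_{X,z}` is a discrete valuation ring: either `h ∈ 𝒪_{X,z}`, and then `ord_z h = 0` forbids
`h ∈ 𝔪_z` — ★ `IsRegularAt.ord_pos` —, or `h⁻¹ ∈ 𝒪_{X,z}` with `ord_z h⁻¹ = −ord_z h = 0`, and the same
argument makes `h⁻¹`, hence `h`, a unit). [cite: Matsumura1987, Thm. 11.2 (p. 79)] [cite: GortzWedhorn2020, (11.13.3) and Lemma 11.37 (p. 309)] -/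
theorem isUnitAt_of_ord_eq_zero [IsLocallyNoetherian X] {z : X} (hz : coheight z = 1)
    (hreg : IsRegularLocalRing (X.presheaf.stalk z)) {h : X.functionField} (h0 : h ≠ 0)
    (hord : Scheme.ord h z = 0) : IsUnitAt z h := by
  haveI := hreg
  haveI := Literature.AlgebraicGeometry.Resolution.isDomain_of_isRegularLocalRing (X.presheaf.stalk z)
  haveI := valuationRing_of_isRegularLocalRing_of_ringKrullDim_le_one (X.presheaf.stalk z)
    (ringKrullDim_stalk_le_one_of_coheight_le_one hz.le)
  rcases ValuationRing.isInteger_or_isInteger (X.presheaf.stalk z) h with hint | hint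
  · have hreg' : IsRegularAt z h := (isRegularAt_iff_isInteger z h).mpr hint
    by_contra hu
    have := hreg'.ord_pos hu h0 hz
    omega
  · have hreg' : IsRegularAt z h⁻¹ := (isRegularAt_iff_isInteger z h⁻¹).mpr hint
    have hord' : Scheme.ord h⁻¹ z = 0 := by
      have hmul := Scheme.ord_mul (x := z) h0 (inv_ne_zero h0)
      rw [mul_inv_cancel₀ h0, (isUnitAt_one (x := z)).ord_eq_zero, hord, zero_add] at hmul
      exact hmul.symm
    by_contra hu
    have hu' : ¬ IsUnitAt z h⁻¹ := fun h1 => hu (by simpa using h1.inv)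
    have := hreg'.ord_pos hu' (inv_ne_zero h0) hz
    omega

/-! ## §2 Algebraic Hartogs (no cover): regularity at the points of codimension `≤ 1` suffices -/

/-- **Algebraic Hartogs on an affine chart**: `X` integral with regular local rings, `V ⊆ X` an affine
open, `h ∈ K(X)` regular at every point of `V` of codimension `≤ 1`.  Then `h` is regular at every point
of `V`: `𝒪_{X,y}` is factorial (Auslander–Buchsbaum–Nagata), so it suffices that `h ∈ (𝒪_{X,y})_{(ϖ)}`
for every prime element `ϖ`; this localisation is the local ring of the codimension-`≤ 1` generization
`y_ϖ ∈ V` of `y`, where `h` is regular by hypothesis.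
[cite: GortzWedhorn2020, Thm. 6.45 (p. 167) and Prop. B.73 (3) (p. 571)] [cite: Matsumura1987, Thm. 20.3] -/
theorem isRegularAt_of_forall_coheight_le_one_affine (hX : Scheme.IsRegular X) {V : X.Opens}
    (hV : IsAffineOpen V) {h : X.functionField}
    (hh : ∀ z : X, z ∈ V → coheight z ≤ 1 → IsRegularAt z h) (y : V) : IsRegularAt (y : X) h := by
  classical
  haveI : Nonempty V := ⟨y⟩
  haveI : IsRegularLocalRing (X.presheaf.stalk (y : X)) := hX y
  haveI := Literature.AlgebraicGeometry.Resolution.isDomain_of_isRegularLocalRing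
    (X.presheaf.stalk (y : X))
  haveI : UniqueFactorizationMonoid (X.presheaf.stalk (y : X)) :=
    Literature.AlgebraicGeometry.Resolution.IsRegularLocalRing.uniqueFactorizationMonoid _
  haveI := hV.isLocalization_stalk y
  -- Hartogs for the factorial ring `𝒪_{X,y}`
  suffices hx : ∀ ϖ : X.presheaf.stalk (y : X), Prime ϖ → ∃ d e : X.presheaf.stalk (y : X),
      ¬ ϖ ∣ e ∧ h * toFunctionField (y : X) e = toFunctionField (y : X) d by
    obtain ⟨r, hr⟩ := exists_algebraMap_eq_of_forall_prime (R := X.presheaf.stalk (y : X)) h hx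
    exact ⟨r, hr⟩
  intro ϖ hϖ
  -- the height-one prime `(ϖ)` and its trace `p` on `Γ(X, V)`; the point `y' = y_ϖ`
  haveI hϖp : (span {ϖ} : Ideal (X.presheaf.stalk (y : X))).IsPrime :=
    (span_singleton_prime hϖ.ne_zero).2 hϖ
  have hϖ1 : (span {ϖ} : Ideal (X.presheaf.stalk (y : X))).height ≤ 1 :=
    height_le_one_of_isPrincipal_of_mem_minimalPrimes (span {ϖ}) (span {ϖ})
      (by rw [Ideal.minimalPrimes_eq_subsingleton_self]; exact Set.mem_singleton _)
  set p : Ideal Γ(X, V) := (span {ϖ} : Ideal (X.presheaf.stalk (y : X))).under Γ(X, V) with hp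
  haveI hpp : p.IsPrime := IsPrime.under _ _
  obtain ⟨y', hpy'⟩ : ∃ y' : V, hV.primeIdealOf y' = ⟨p, hpp⟩ :=
    ⟨⟨hV.fromSpec ⟨p, hpp⟩, hV.range_fromSpec.le ⟨_, rfl⟩⟩, by
      apply hV.fromSpec.isOpenEmbedding.injective
      rw [hV.fromSpec_primeIdealOf]⟩
  -- `𝒪_{X,y'}` has dimension `= ht p = ht (ϖ) ≤ 1`, so `y'` has codimension `≤ 1`
  haveI := hV.isLocalization_stalk y'
  have hdim : ringKrullDim (X.presheaf.stalk (y' : X)) ≤ 1 := by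
    rw [IsLocalization.AtPrime.ringKrullDim_eq_height (hV.primeIdealOf y').asIdeal
      (X.presheaf.stalk (y' : X)), hpy']
    change ((p.height : ℕ∞) : WithBot ℕ∞) ≤ 1
    rw [hp, IsLocalization.height_under (hV.primeIdealOf y).asIdeal.primeCompl
      (span {ϖ} : Ideal (X.presheaf.stalk (y : X)))]
    exact_mod_cast hϖ1
  -- so `h` is regular at `y'` by hypothesis
  have hreg' : IsRegularAt (y' : X) h :=
    hh y' y'.2 (coheight_le_one_of_ringKrullDim_stalk_le_one hdim)
  -- read off a denominator not divisible by `ϖ`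
  obtain ⟨a, b, hb, e⟩ := (isRegularAt_iff_exists hV y' h).1 hreg'
  rw [hpy'] at hb
  refine ⟨algebraMap Γ(X, V) _ a, algebraMap Γ(X, V) _ b, fun hdvd => hb ?_, ?_⟩
  · exact mem_comap.2 (mem_span_singleton.2 hdvd)
  · rw [toFunctionField_algebraMap_stalk, toFunctionField_algebraMap_stalk, e]

/-- **Algebraic Hartogs**: `X` integral with regular local rings, `W ⊆ X` open and `h ∈ K(X)` regular at
every point of `W` of codimension `≤ 1`.  Then `h` is regular at every point of `W` (Görtz–Wedhorn I,
Thm. 6.45: `Γ(W, 𝒪_X) = ⋂_{x ∈ W, codim x ≤ 1} 𝒪_{X,x}` inside `K(X)`). [cite: GortzWedhorn2020, Thm. 6.45 (p. 167)] [cite: Hartshorne1977, II.6 Prop. 6.3A] -/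
theorem isRegularAt_of_forall_coheight_le_one (hX : Scheme.IsRegular X) {W : X.Opens}
    {h : X.functionField} (hh : ∀ z : X, z ∈ W → coheight z ≤ 1 → IsRegularAt z h)
    {y : X} (hy : y ∈ W) : IsRegularAt y h := by
  obtain ⟨V, hV, hyV, hVW⟩ := exists_isAffineOpen_mem_and_subset (U := W) hy
  exact isRegularAt_of_forall_coheight_le_one_affine hX hV (fun z hz hz1 => hh z (hVW hz) hz1) ⟨y, hyV⟩

/-- **Hartogs for units**: `X` integral, locally Noetherian, with regular local rings; `W ⊆ X` open;
`h ∈ K(X)` nonzero with `ord_z h = 0` at every codimension-ONE point `z ∈ W`.  Then `h` is a unit of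
`𝒪_{X,y}` for every `y ∈ W` (apply Hartogs to `h` and to `h⁻¹`; at the generic point every nonzero
rational function is a unit). [cite: GortzWedhorn2020, Thm. 6.45 (p. 167)] [cite: GortzWedhorn2020, (11.13.3) and Lemma 11.37 (p. 309)] -/
theorem isUnitAt_of_forall_ord_eq_zero [IsLocallyNoetherian X] (hX : Scheme.IsRegular X)
    {W : X.Opens} {h : X.functionField} (h0 : h ≠ 0)
    (hh : ∀ z : X, z ∈ W → coheight z = 1 → Scheme.ord h z = 0) {y : X} (hy : y ∈ W) :
    IsUnitAt y h := by
  -- at every point of `W` of codimension `≤ 1`, `h` is a unit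
  have hunit : ∀ z : X, z ∈ W → coheight z ≤ 1 → IsUnitAt z h := by
    intro z hz hz1
    rcases hz1.lt_or_eq with hlt | heq
    · have h0' : coheight z = 0 := Order.lt_one_iff.mp hlt
      have hzgen : z = genericPoint X := by
        rw [Order.coheight_eq_zero] at h0'
        have h1 : z ≤ genericPoint X := genericPoint_specializes z
        have h2 : genericPoint X ≤ z := h0' h1
        exact (Specializes.antisymm (Scheme.le_iff_specializes.mp h2)
          (Scheme.le_iff_specializes.mp h1)).eq
      subst hzgen
      exact isUnitAt_genericPoint h0
    · exact isUnitAt_of_ord_eq_zero heq (hX z) h0 (hh z hz heq)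
  rw [isUnitAt_iff]
  refine ⟨h0, ?_, ?_⟩
  · exact isRegularAt_of_forall_coheight_le_one hX (fun z hz hz1 => (hunit z hz hz1).isRegularAt) hy
  · exact isRegularAt_of_forall_coheight_le_one hX
      (fun z hz hz1 => (hunit z hz hz1).inv.isRegularAt) hy

end RatFn

/-! ## §3 `Div(X) → Z¹(X)` is injective on a regular scheme -/

namespace CartierDivisor

open RatFn

variable {X : Scheme.{u}} [IsIntegral X] [IsLocallyNoetherian X]

/-- **Cartier divisors on a regular scheme with the same order at every codimension-one point are the
same divisor**: for presentations `D = (U_i, f_i)`, `E = (V_j, g_j)` and `x ∈ U_i ∩ V_j`, the rational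
function `f_i / g_j` has order `ord_z(D) − ord_z(E) = 0` at every codimension-one point `z` of
`U_i ∩ V_j`, hence is a unit of `𝒪_{X,x}` by Hartogs (`RatFn.isUnitAt_of_forall_ord_eq_zero`).
[cite: Hartshorne1977, II.6 Prop. 6.11 and Remark 6.11.2 (pp. 141–142)] [cite: GortzWedhorn2020, Thm. 11.38 (1)] -/
theorem sameDivisor_of_forall_ordAt_eq (hX : Scheme.IsRegular X) {D E : CartierDivisor X}
    (h : ∀ z : X, coheight z = 1 → D.ordAt z = E.ordAt z) : D.SameDivisor E := by
  intro i j x hi hj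
  have hf : D.f i ≠ 0 := D.f_ne_zero i
  have hg : E.f j ≠ 0 := E.f_ne_zero j
  refine isUnitAt_of_forall_ord_eq_zero hX (W := D.U i ⊓ E.U j) (div_ne_zero hf hg)
    (fun z hz hz1 => ?_) ⟨hi, hj⟩
  have hz' : z ∈ D.U i ∧ z ∈ E.U j := hz
  have hmul : Scheme.ord (D.f i / E.f j * E.f j) z = Scheme.ord (D.f i / E.f j) z + Scheme.ord (E.f j) z :=
    Scheme.ord_mul (div_ne_zero hf hg) hg
  rw [div_mul_cancel₀ _ hg, ← D.ordAt_eq_ord hz'.1, ← E.ordAt_eq_ord hz'.2, h z hz1] at hmul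
  omega

/-- **`SameDivisor` iff equal orders at every codimension-one point** (on a regular scheme).
[cite: Hartshorne1977, II.6 Prop. 6.11 and Remark 6.11.2 (pp. 141–142)] -/
theorem sameDivisor_iff_forall_ordAt_eq (hX : Scheme.IsRegular X) {D E : CartierDivisor X} :
    D.SameDivisor E ↔ ∀ z : X, coheight z = 1 → D.ordAt z = E.ordAt z :=
  ⟨fun hDE z _ => hDE.ordAt_eq z, sameDivisor_of_forall_ordAt_eq hX⟩

/-- **The cycle map `Div(X) → Z¹(X)`, `D ↦ cyc(D)` (★ `CartierDivisor.cycle`), is injective on a regular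
scheme** (up to `SameDivisor`, the equality of `Div(X)`). [cite: GortzWedhorn2020, Thm. 11.38 (1)] [cite: Hartshorne1977, II.6 Prop. 6.11 and Remark 6.11.2 (pp. 141–142)] -/
theorem sameDivisor_of_cycle_eq (hX : Scheme.IsRegular X) {D E : CartierDivisor X}
    (h : D.cycle = E.cycle) : D.SameDivisor E :=
  sameDivisor_of_forall_ordAt_eq hX fun z _ => by rw [← cycle_apply, ← cycle_apply, h]

/-- `SameDivisor` iff equal Weil cycles (on a regular scheme). [cite: GortzWedhorn2020, Thm. 11.38 (1)] -/
theorem sameDivisor_iff_cycle_eq (hX : Scheme.IsRegular X) {D E : CartierDivisor X} :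
    D.SameDivisor E ↔ D.cycle = E.cycle :=
  ⟨SameDivisor.cycle_eq, sameDivisor_of_cycle_eq hX⟩

/-- **A Cartier divisor with order `0` at every codimension-one point is (the same divisor as) `0`** on a
regular scheme. [cite: Hartshorne1977, II.6 Prop. 6.11 and Remark 6.11.2 (pp. 141–142)] -/
theorem sameDivisor_zero_of_forall_ordAt_eq_zero (hX : Scheme.IsRegular X) {D : CartierDivisor X}
    (h : ∀ z : X, coheight z = 1 → D.ordAt z = 0) : D.SameDivisor 0 :=
  sameDivisor_of_forall_ordAt_eq hX fun z hz => by rw [h z hz, ordAt_zero]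

end CartierDivisor

end Literature.AlgebraicGeometry.Motives

end
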